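import Summits.Ventures.PercRepro.RankLevelSetIndepCDCross

/-! # RankLevelSetIndepCDOfSRI — (SRI) ON THE MINORS OF `M` IMPLIES (CD) FOR `M`: THE AVERAGED ELEMENT INDUCTION OF
THE CONTRACTION/DELETION LIKELIHOOD-RATIO ORDER (night-1 g28; dossier §40)

`RankLevelSetIndepCD` states (CD): for `e ∈ E` and `x_k = contractCount M e k`, `y_k = deleteCount M e k` (the
independence profiles of `M / e` and `M ∖ e`), `x_{k+1} y_k ≤ x_k y_{k+1}`. `RankLevelSetIndepSRI` states (SRI): for
`y ≠ e` and `I_p^A = sliceCount M y e A p`, `I_p^∅ I_p^{ye} ≤ I_p^y I_p^e`. Both are census-clean (0 failures on all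
383,172 matroids on 9 elements and every family tried) and open. THIS MODULE proves the kernel link
**(SRI) for every minor (indeed every contraction) of `M` ⟹ (CD) for `M`**, with the identities of
`RankLevelSetIndepCDSplit` / `RankLevelSetIndepCDCross`: `(k + 2) · x_{k+2} · y_{k+1} = Σ_{f ≠ e} I^{ef}_{k+1} · (I^∅_{k+1} + I^f_k)` and
`(k + 2) · x_{k+1} · y_{k+2} = Σ_{f ≠ e} (I^e_{k+1} + I^{ef}_k) · I^f_{k+1}`, and TERMWISE IN `f`:
`I^{ef}_{k+1} I^∅_{k+1} ≤ I^e_{k+1} I^f_{k+1}` is (SRI) at the pair `(e, f)` and level `k + 1`, while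
`I^{ef}_{k+1} I^f_k ≤ I^{ef}_k I^f_{k+1}` is the (CD) step of the CONTRACTION `M / f` at `e` and level `k`
(`contractCount (M / f) e k = I^{ef}_k`, `deleteCount (M / f) e k = I^f_k` for a non-loop `f`; both vanish for a loop).
**`indepCDStep_succ_of_sri`** (and `indepCDStep_zero_of_sri` at level `0`) is the step;
**`indepCD_of_sri_contract : (∀ C ⊆ E, IndepSRI (M / C)) → IndepCD M`** is the strong induction on `#E`
(`contract_contract`, `contract_empty`); `indepCD_of_sri_minor` and `indepCD_of_sri_all` are the corollaries. The
cell's paper remark «(SRI) for `U_{1,2} ⊕ M` at `(y ∈ U_{1,2}, e ∈ M)` is (CD)(M; e)» (dossier §39.5) is thereby a kernel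
theorem in its minor-closed form: (SRI) for every finite matroid implies (CD) for every finite matroid. Nothing here
asserts (SRI) or (CD); every declaration has a docstring; imports: the cell's own modules and Mathlib only.
Axioms: standard. -/

namespace PercRepro

open Set Matroid Finset

variable {α : Type} (M : Matroid α) [M.Finite]

/-! ## The inductive step -/

/-- **The (CD) step at level `0` from (SRI) at level `0`**: `x_1 · y_0 ≤ x_0 · y_1`. -/
theorem indepCDStep_zero_of_sri {e : α} (he : e ∈ M.E)
    (hSRI : ∀ f ∈ M.E, f ≠ e →
      sliceCount M e f ∅ 0 * sliceCount M e f {e, f} 0 ≤ sliceCount M e f {e} 0 * sliceCount M e f {f} 0) :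
    contractCount M e 1 * deleteCount M e 0 ≤ contractCount M e 0 * deleteCount M e 1 := by
  classical
  have h1 : contractCount M e 1 * deleteCount M e 0 =
      ∑ f ∈ M.ground_finite.toFinset.erase e, sliceCount M e f {e, f} 0 * sliceCount M e f ∅ 0 := by
    have := succ_mul_contractCount M he 0
    rw [zero_add, one_mul] at this
    rw [this, Finset.sum_mul]
    exact Finset.sum_congr rfl (fun f _ => by rw [deleteCount_zero_eq_slice M e f])
  have h2 : contractCount M e 0 * deleteCount M e 1 =
      ∑ f ∈ M.ground_finite.toFinset.erase e, sliceCount M e f {e} 0 * sliceCount M e f {f} 0 := by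
    have := succ_mul_deleteCount M he 0
    rw [zero_add, one_mul] at this
    rw [this, Finset.mul_sum]
    exact Finset.sum_congr rfl (fun f _ => by rw [contractCount_zero_eq_slice M e f])
  rw [h1, h2]
  refine Finset.sum_le_sum (fun f hf => ?_)
  have hf' := Finset.mem_erase.mp hf
  rw [mul_comm]
  exact hSRI f (M.ground_finite.mem_toFinset.mp hf'.2) hf'.1

/-- **THE INDUCTIVE STEP OF (CD), AVERAGED OVER THE SECOND ELEMENT**: (SRI) at `(e, f)` and level `k + 1` for every
`f ≠ e`, together with the (CD) step at level `k` of every contraction `M / f` (in slice language: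
`I^{ef}_{k+1} I^f_k ≤ I^{ef}_k I^f_{k+1}`), give the (CD) step `x_{k+2} y_{k+1} ≤ x_{k+1} y_{k+2}` of `M` at `e`. -/
theorem indepCDStep_succ_of_sri {e : α} (he : e ∈ M.E) (k : ℕ)
    (hSRI : ∀ f ∈ M.E, f ≠ e → sliceCount M e f ∅ (k + 1) * sliceCount M e f {e, f} (k + 1) ≤
      sliceCount M e f {e} (k + 1) * sliceCount M e f {f} (k + 1))
    (hCD : ∀ f ∈ M.E, f ≠ e → sliceCount M e f {e, f} (k + 1) * sliceCount M e f {f} k ≤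
      sliceCount M e f {e, f} k * sliceCount M e f {f} (k + 1)) :
    contractCount M e (k + 2) * deleteCount M e (k + 1) ≤ contractCount M e (k + 1) * deleteCount M e (k + 2) := by
  classical
  have h1 : (k + 2) * (contractCount M e (k + 2) * deleteCount M e (k + 1)) =
      ∑ f ∈ M.ground_finite.toFinset.erase e,
        sliceCount M e f {e, f} (k + 1) * (sliceCount M e f ∅ (k + 1) + sliceCount M e f {f} k) := by
    rw [← mul_assoc, succ_mul_contractCount M he (k + 1), Finset.sum_mul]
    refine Finset.sum_congr rfl (fun f hf => ?_)
    rw [deleteCount_split M e f (Finset.mem_erase.mp hf).1 k]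
  have h2 : (k + 2) * (contractCount M e (k + 1) * deleteCount M e (k + 2)) =
      ∑ f ∈ M.ground_finite.toFinset.erase e,
        (sliceCount M e f {e} (k + 1) + sliceCount M e f {e, f} k) * sliceCount M e f {f} (k + 1) := by
    rw [mul_left_comm, succ_mul_deleteCount M he (k + 1), Finset.mul_sum]
    refine Finset.sum_congr rfl (fun f hf => ?_)
    rw [contractCount_split M e f (Finset.mem_erase.mp hf).1 k]
  have hsum : ∑ f ∈ M.ground_finite.toFinset.erase e,
        sliceCount M e f {e, f} (k + 1) * (sliceCount M e f ∅ (k + 1) + sliceCount M e f {f} k) ≤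
      ∑ f ∈ M.ground_finite.toFinset.erase e,
        (sliceCount M e f {e} (k + 1) + sliceCount M e f {e, f} k) * sliceCount M e f {f} (k + 1) := by
    refine Finset.sum_le_sum (fun f hf => ?_)
    have hf' := Finset.mem_erase.mp hf
    have hfE := M.ground_finite.mem_toFinset.mp hf'.2
    have hs := hSRI f hfE hf'.1
    have hc := hCD f hfE hf'.1
    rw [mul_add, add_mul]
    refine add_le_add ?_ hc
    rw [mul_comm]
    exact hs
  have h3 : (k + 2) * (contractCount M e (k + 2) * deleteCount M e (k + 1)) ≤
      (k + 2) * (contractCount M e (k + 1) * deleteCount M e (k + 2)) := by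
    rw [h1, h2]; exact hsum
  exact Nat.le_of_mul_le_mul_left h3 (by omega)

/-! ## (SRI) on the contractions implies (CD) -/

/-- **(SRI) FOR EVERY CONTRACTION OF `M` IMPLIES (CD) FOR `M`**, by strong induction on the size of the ground set:
the level-`0` step needs (SRI) of `M` at level `0`; the step from level `k` to `k + 1` at `e` needs (SRI) of `M` at
`(e, f)` and level `k + 1` for every `f ≠ e` and the (CD) step at level `k` of every contraction `M / f` at `e`
(from the induction hypothesis for `M / f`, whose contractions are contractions of `M`; loops `f` contribute
`0 ≤ 0`). -/
theorem indepCD_of_sri_contract (h : ∀ C ⊆ M.E, IndepSRI (M ／ C)) : IndepCD M := by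
  classical
  suffices H : ∀ n : ℕ, ∀ (N : Matroid α) [N.Finite], N.E.ncard = n →
      (∀ C ⊆ N.E, IndepSRI (N ／ C)) → IndepCD N from H _ M rfl h
  intro n
  induction n using Nat.strong_induction_on with
  | _ n ih =>
    intro N hNfin hNn hN
    have hSRI : IndepSRI N := by simpa using hN ∅ (Set.empty_subset _)
    intro e he k
    induction k with
    | zero =>
      exact indepCDStep_zero_of_sri N he (fun f hf hfe => hSRI e he f hf (Ne.symm hfe) 0)
    | succ k _ =>
      refine indepCDStep_succ_of_sri N he k (fun f hf hfe => hSRI e he f hf (Ne.symm hfe) (k + 1)) ?_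
      intro f hf hfe
      by_cases hfl : N.Indep {f}
      · -- the (CD) step of the contraction `N / f`, by the induction hypothesis
        have hfin : (N ／ {f}).E.ncard < n := by
          rw [contract_ground, ← hNn]
          exact Set.ncard_sdiff_singleton_lt_of_mem hf N.ground_finite
        have hcontr : ∀ C ⊆ (N ／ {f}).E, IndepSRI ((N ／ {f}) ／ C) := by
          intro C hC
          rw [contract_contract]
          refine hN ({f} ∪ C) (Set.union_subset (Set.singleton_subset_iff.mpr hf) ?_)
          rw [contract_ground] at hC
          exact hC.trans Set.sdiff_subset
        have hCD := ih _ hfin (N ／ {f}) rfl hcontr e (by rw [contract_ground]; exact ⟨he, fun h => hfe (Set.mem_singleton_iff.mp h).symm⟩) k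
        rwa [contractCount_contract_eq_slice N hfe hfl, deleteCount_contract_eq_slice N hfl,
          contractCount_contract_eq_slice N hfe hfl, deleteCount_contract_eq_slice N hfl] at hCD
      · rw [sliceCount_eq_zero_of_loop N hfl {e, f} (by simp) (k + 1), zero_mul]
        exact Nat.zero_le _

/-- **(SRI) for every finite matroid implies (CD) for every finite matroid** (the contractions of a finite matroid
are finite matroids). -/
theorem indepCD_of_sri_all (hall : ∀ (N : Matroid α) [N.Finite], IndepSRI N) : IndepCD M :=
  indepCD_of_sri_contract M (fun C _ => hall (M ／ C))

/-- **(SRI) for every minor of `M` implies (CD) for `M`** (`N ≤m M` is Mathlib's minor relation `∃ C D, N = M / C ∖ D`). -/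
theorem indepCD_of_sri_minor (h : ∀ N : Matroid α, N ≤m M → IndepSRI N) : IndepCD M :=
  indepCD_of_sri_contract M (fun C _ => h (M ／ C) ⟨C, ∅, by simp⟩)

end PercRepro
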